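import Mathlib
import HarnessLib
import Summits.AtomisticToContinuum.Crystallization.Theorems.PricedLinkCensusSoftFourRingsReduction
import Summits.AtomisticToContinuum.Crystallization.Theorems.PricedLinkCensusSoftFourRingsBridge
import Summits.AtomisticToContinuum.Crystallization.Theorems.PricedLinkCensusSoftFourRingsInterior
import Summits.AtomisticToContinuum.Crystallization.Theorems.PricedLinkCensusSoftFourRingsNoSlack
import Summits.AtomisticToContinuum.Crystallization.Theorems.PricedLinkCensusSoftFourRingsDefs

/-!
# Soft four-rings: assembly modulo endgame rigidity

Route `PricedLinkCensus`, sub-problem `Crystallization`, item `SoftFourRings`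
(stmt-AtomisticToContinuum-14234).

`softFourRings_of_endgameRigidity` :
  `musinTarasov2012_tammes_thirteen → δ ≤ 6/25 → EndgameRigidity δ → SoftFourRings`.

Chain: `softFourRings_of_twelve_unit` (reduction to twelve normalised points) →
`hull_setting_of_twelve` (unit directions `X`, bonds `B`) → `hull_counts_of_twelve`,
`no_slack_one_percent` (hull structure: facets are triangles/quadrilaterals, `8` bond triangles,
two at every vertex; conditional on Tammes-13) → `EndgameRigidity δ` (rotation `A` and
pattern `P` matched within `δ ≤ 6/25` by the directions) → the points `z j` are within `η ≤ 1/100`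
of their directions, so within `1/4`.
-/

namespace Summit.AtomisticToContinuum.Crystallization.Theorems

open Real RealInnerProductSpace Literature.Geometry.DiscreteGeometry

/-- **`SoftFourRings` modulo Tammes-13 and endgame rigidity.** -/
theorem softFourRings_of_endgameRigidity (hT : musinTarasov2012_tammes_thirteen)
    {δ : ℝ} (hδ : δ ≤ 6 / 25) (hER : EndgameRigidity δ) :
    Summit.AtomisticToContinuum.Crystallization.Theses.PricedLinkCensus.SoftFourRings := by
  refine softFourRings_of_twelve_unit fun η hη hη1 z n h1 h2 h3 h4 h5 => ?_
  obtain ⟨X, B, hX1, hcard, hsepX, hB, hBcard, hdeg, hnonbond, hclose⟩ :=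
    hull_setting_of_twelve hη hη1 h1 h2 h3 h4 h5
  have h0 : (0 : EuclideanSpace ℝ (Fin 3)) ∈
      interior (convexHull ℝ (X : Set (EuclideanSpace ℝ (Fin 3)))) :=
    zero_mem_interior_convexHull_of_twelve_le_card hT hX1 hcard.ge
      (ca := 1 - 1 / (2 * (101 / 100 : ℝ) ^ 2)) (by norm_num) hsepX
  obtain ⟨-, -, -, -, -, h34, -, -⟩ := hull_counts_of_twelve hT hX1 hcard hsepX hB hBcard
  obtain ⟨hT8, ht2⟩ := no_slack_one_percent hT hX1 hcard hsepX hB hBcard hdeg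
  obtain ⟨A, P, hP, hAP⟩ := hER X B hX1 hcard hsepX hB hBcard hdeg hnonbond h0 h34 hT8 ht2
  refine ⟨A, P, hP, fun p hp => ?_⟩
  obtain ⟨x, hx, hd⟩ := hAP p hp
  obtain ⟨j, hj⟩ := hclose x hx
  exact ⟨j, by linarith [dist_triangle (z j) x (A p)]⟩

end Summit.AtomisticToContinuum.Crystallization.Theorems
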